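import Summits.BirchSwinnertonDyer.Rank1Residual.GaloisImage.ThreeTorsionInertiaTame
import Summits.BirchSwinnertonDyer.Rank1Residual.GaloisImage.TameInertiaStableComplement
import HarnessLib

/-!
# `p ∤ e_p` ⟹ the inertia image `ρ̄_{E,p}(I_𝔓)` is CYCLIC with ONE tame generator; a stable pair
# forces `e_p ∣ p − 1` — part 6a of the O8-TAME kernel theorems, valid on EVERY O8 row
# (potentially supersingular and wild rows included: no twist model, no type hypothesis)
# (cell `b2b-bsdres`, lane CLASS-CLOSURE, seat cc-typer-1 = typer of record N11 / O8;
# `class-closure/O8/STATEMENT.md` §19; sequel `GaloisImage/SmallImageNiveauDichotomy.lean`)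

HONEST FRAMING (cell `b2b-bsdres`, run/shared/lean/b2b/bsd-rank1-residual/, verbatim in every
file): the goal of the cell is to DELETE the COMBINATION-SHAPED residual classes of the
Birch–Swinnerton-Dyer formula for ALL analytic-rank `≤ 1` elliptic curves over `ℚ` — "full BSD
formula for every rank `≤ 1` curve in class `C`" assembled STRICTLY from published theorems — so
that the rank-`≤ 1` remainder becomes exactly the CONSTRUCTION-SHAPED classes, which are TYPED
(missing-input `Prop`s), NOT attempted. This is not "finishing BSD". Lane CLASS-CLOSURE: research
routes, no claim beyond the stated classes; census output = EVIDENCE, never a Literature fact;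
NOTHING is booked here. This file contains THEOREMS ONLY (Hilbert ramification theory of the
`p`-division field `ℚ(E[p])` over tree predicates); no definition, no named fact, no conjecture,
no `sorry`.

## What is proved

Notation: `E = W/ℚ` elliptic, `p` prime, `v ∋ p` the place of `ℚ`, `𝔓 ∣ v` a prime of `ℤ̄`,
`I = I_𝔓 ≤ Γ_ℚ` its inertia group, `ρ̄ = galoisRepTorsion W p`, `e_p := #ρ̄(I)` (p02's datum of row
T-b9; parts 4–5 `SmallImageInertiaOrder` / `TameInertiaStableComplement`).

* §1 `exists_generator_inertia_galoisRepTorsion_of_not_dvd_card` — **`p ∤ e_p ⟹ ρ̄(I) = ⟨ρ̄(s)⟩`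
  for ONE `s ∈ I`**: every `x ∈ I` acts on `E[p]` as a power `s^k`
  (`exists_generator_inertia_smul_of_not_dvd_card`), `ρ̄(I)` is cyclic
  (`isCyclic_inertia_map_galoisRepTorsion_of_not_dvd_card`), `e_p = ord ρ̄(s)`
  (`exists_card_inertia_map_eq_orderOf_of_not_dvd_card`).  Proof (Serre, *Corps locaux* IV §2
  Cor. 1 and Cor. 3, in the GLOBAL Dedekind form of the tree's `TameInertiaCharacterGlobalProofs`,
  set up exactly as in p02's `ThreeTorsionInertiaTame`): at `P_L = 𝔓 ∩ ℚ(E[p])`,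
  `ρ̄(I) ≅ G₀(P_L)` (Hilbert theory, `inertia_comap_eq_map_absRestrictNormalHom`), the wild group
  `G₁(P_L)` is a `p`-group (`Ideal.isPGroup_ramificationSubgroup_one`) of order dividing
  `#G₀ = e_p`, hence TRIVIAL, and `G₀/G₁` is cyclic
  (`exists_generator_inertia_mod_ramificationSubgroup_one`, the tame character into `κ(P_L)ˣ`).
  Small-image forms (`Irr W p ∧ ¬ Surj W p ⟹ p ∤ e_p`, part 4): `…_of_irr_of_not_surj`.
* §1b `card_inertia_map_dvd_sub_one_of_stablePair` — a stable pair forces `e_p ∣ p − 1`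
  (NIVEAU 1), every `p`: part 4's `σ^{p−1} = 1` read on the tame generator.

The `p = 3` dichotomy `e₃ ∈ {2, 8}` (`e₃ = 2 ⟺ InertiaSplitAt`, `e₃ = 8 ⟺` no stable line) and
the `3Ns` consequence are the sequel `GaloisImage/SmallImageNiveauDichotomy.lean`.  Nothing about
BSD_p; O8 / N2 / N3 stay OPEN; nothing is booked.

References: J.-P. Serre, *Corps locaux* (1968) Ch. IV §2 Prop. 7, Cor. 1 and Cor. 3
[SerreLocalFields1979]; J.-P. Serre, Invent. Math. 15 (1972) §1.3, §2.4 Prop. 15 [Serre1972];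
class-closure/O8/STATEMENT.md §§12–19.
-/

noncomputable section

open scoped Classical NumberField Pointwise
open Field IsDedekindDomain WeierstrassCurve

-- As in `GaloisImage/ThreeTorsionInertiaTame` (p02): pin `Algebra ℚ ℚ̄` to
-- `AlgebraicClosure.instAlgebra`; `Subsingleton (Algebra ℚ _)`, nothing overridden in substance.
attribute [local instance 1001] IntermediateField.algebra'
attribute [local instance 1002] AlgebraicClosure.instAlgebra

namespace Summit.BirchSwinnertonDyer.Rank1Residual.GaloisImage

open Literature.NumberTheory.EllipticCurves Literature.NumberTheory.GaloisRepresentations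
  Rat.HeightOneSpectrum NumberField
  Literature.NumberTheory.EllipticCurves.Rank1Residual
  Summit.BirchSwinnertonDyer.Rank1Residual.Additive.MixedCongruence

/-! ## §0. Two group-theoretic trivialities -/

/-- Two homomorphisms with the same kernel identify the same pairs of elements. [folklore] -/
private theorem apply_eq_iff_of_ker_eq' {G H₁ H₂ : Type*} [Group G] [Group H₁] [Group H₂]
    (f₁ : G →* H₁) (f₂ : G →* H₂) (h : f₁.ker = f₂.ker) (x y : G) : f₁ x = f₁ y ↔ f₂ x = f₂ y := by
  constructor
  · intro hxy
    have hmem : x⁻¹ * y ∈ f₂.ker := by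
      rw [← h, MonoidHom.mem_ker, map_mul, map_inv, hxy, inv_mul_cancel]
    rwa [MonoidHom.mem_ker, map_mul, map_inv, inv_mul_eq_one] at hmem
  · intro hxy
    have hmem : x⁻¹ * y ∈ f₁.ker := by
      rw [h, MonoidHom.mem_ker, map_mul, map_inv, hxy, inv_mul_cancel]
    rwa [MonoidHom.mem_ker, map_mul, map_inv, inv_mul_eq_one] at hmem

/-! ## §1. `p ∤ e_p` ⟹ one tame generator: `ρ̄(I_𝔓) = ⟨ρ̄(s)⟩` -/

section Cyclic

variable {W : WeierstrassCurve ℚ} [W.IsElliptic] {p : ℕ} [Fact p.Prime]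

/-- **`p ∤ #ρ̄_{E,p}(I_𝔓) ⟹ ρ̄_{E,p}(I_𝔓)` is generated by ONE element `ρ̄(s)`, `s ∈ I_𝔓`.**
At the prime `P_L = 𝔓 ∩ ℚ(E[p])` of the `p`-division field, `ρ̄(I_𝔓) ≅ G₀(P_L)` (Hilbert theory,
`inertia_comap_eq_map_absRestrictNormalHom`); the wild group `G₁(P_L)` is a `p`-group
(`Ideal.isPGroup_ramificationSubgroup_one`) of order dividing `#G₀ = e_p`, hence TRIVIAL when
`p ∤ e_p`; and `G₀/G₁` is cyclic (`exists_generator_inertia_mod_ramificationSubgroup_one`, the tame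
character into `κ(P_L)ˣ`).  Serre: "`G₀/G₁` est cyclique … `G₁` est un `p`-groupe".
[cite: SerreLocalFields1979, Ch. IV §2 Prop. 7, Cor. 1 and Cor. 3] -/
theorem exists_generator_inertia_galoisRepTorsion_of_not_dvd_card
    {v : HeightOneSpectrum (𝓞 ℚ)} (hv : ((p : ℕ) : 𝓞 ℚ) ∈ v.asIdeal)
    {𝔓 : Ideal (absIntegers (𝓞 ℚ) ℚ)} (h𝔓 : 𝔓 ∈ v.primesAbove)
    (hI : ¬ p ∣ Nat.card ((𝔓.inertia (absoluteGaloisGroup ℚ)).map (galoisRepTorsion W p))) :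
    ∃ s ∈ 𝔓.inertia (absoluteGaloisGroup ℚ), ∀ x ∈ 𝔓.inertia (absoluteGaloisGroup ℚ),
      ∃ k : ℤ, galoisRepTorsion W p x = galoisRepTorsion W p s ^ k := by
  have hp : p.Prime := Fact.out
  haveI : NeZero p := ⟨hp.ne_zero⟩
  haveI : 𝔓.IsPrime := h𝔓.1
  haveI h𝔓max : 𝔓.IsMaximal := HeightOneSpectrum.isMaximal_of_mem_primesAbove h𝔓
  -- the `p`-division field and the prime `P_L = 𝔓 ∩ 𝓞_L`
  set L := W.divisionField p with hL
  haveI : IsGalois ℚ L := inferInstance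
  haveI hDD : IsDedekindDomain (integralClosure (𝓞 ℚ) L) :=
    integralClosure.isDedekindDomain (𝓞 ℚ) ℚ L
  haveI : IsFractionRing (integralClosure (𝓞 ℚ) L) L :=
    integralClosure.isFractionRing_of_finite_extension ℚ L
  set PL := 𝔓.comap (L.integralClosureToAbsIntegers (𝓞 ℚ)) with hPL
  haveI hPLmax : PL.IsMaximal := isMaximal_comap_integralClosureToAbsIntegers (𝓞 ℚ) 𝔓 L
  have hunder : PL.under (𝓞 ℚ) = v.asIdeal := by
    rw [hPL, under_comap_integralClosureToAbsIntegers, ← h𝔓.2.over]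
  have hpPL : algebraMap (𝓞 ℚ) (integralClosure (𝓞 ℚ) L) ((p : ℕ) : 𝓞 ℚ) ∈ PL := by
    have : ((p : ℕ) : 𝓞 ℚ) ∈ PL.under (𝓞 ℚ) := by rw [hunder]; exact hv
    rwa [Ideal.under_def, Ideal.mem_comap] at this
  have hpN : ((p : ℕ) : integralClosure (𝓞 ℚ) L) ∈ PL := by
    have := hpPL; rwa [map_natCast] at this
  have hPL0 : PL ≠ ⊥ := by
    intro h0
    rw [h0, Ideal.mem_bot] at hpPL
    have hinj : Function.Injective (algebraMap (𝓞 ℚ) (integralClosure (𝓞 ℚ) L)) :=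
      (faithfulSMul_iff_algebraMap_injective _ _).mp
        (faithfulSMul_integralClosure (𝓞 ℚ) (K := ℚ) (L := L))
    have hp0 : ((p : ℕ) : 𝓞 ℚ) = 0 := hinj (hpPL.trans (map_zero _).symm)
    exact hp.ne_zero (by exact_mod_cast hp0)
  -- residue fields: finite, separable
  haveI : Finite ((𝓞 ℚ) ⧸ 𝔓.under (𝓞 ℚ)) := by
    rw [← h𝔓.2.over]; exact Ideal.finiteQuotientOfFreeOfNeBot v.asIdeal v.ne_bot
  haveI hsep : Algebra.IsSeparable ((𝓞 ℚ) ⧸ PL.under (𝓞 ℚ)) (integralClosure (𝓞 ℚ) L ⧸ PL) :=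
    isSeparable_residue_comap (𝓞 ℚ) 𝔓 L
  haveI : Algebra.IsSeparable ℚ L := Algebra.IsSeparable.of_integral ℚ L
  haveI : Module.Finite (𝓞 ℚ) (integralClosure (𝓞 ℚ) L) :=
    IsIntegralClosure.finite (𝓞 ℚ) ℚ L (integralClosure (𝓞 ℚ) L)
  haveI hfin : Finite (integralClosure (𝓞 ℚ) L ⧸ PL) :=
    (Ring.HasFiniteQuotients.of_module_finite (𝓞 ℚ) (integralClosure (𝓞 ℚ) L)).finiteQuotient hPL0
  -- the inertia group `G₀` and the wild inertia group `G₁` of `P_L`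
  set G₀ := PL.inertia (L ≃ₐ[ℚ] L) with hG₀
  set G₁ := PL.ramificationSubgroup (L ≃ₐ[ℚ] L) 1 with hG₁
  have hG₁le : G₁ ≤ G₀ := Ideal.ramificationSubgroup_le_inertia PL (L ≃ₐ[ℚ] L) 1
  have hG₁p : IsPGroup p G₁ := by
    haveI := faithfulSMul_algEquiv_integralClosure (𝓞 ℚ) (K := ℚ) (L := L)
    haveI : IsNoetherianRing (integralClosure (𝓞 ℚ) L) :=
      IsIntegralClosure.isNoetherianRing (𝓞 ℚ) ℚ L (integralClosure (𝓞 ℚ) L)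
    exact Ideal.isPGroup_ramificationSubgroup_one PL (L ≃ₐ[ℚ] L) Ideal.IsPrime.ne_top' hpN
  obtain ⟨g, hgG₀, hgen⟩ :=
    exists_generator_inertia_mod_ramificationSubgroup_one (K := ℚ) PL hPL0
  -- `#ρ̄(I_𝔓) = #G₀` (Hilbert theory: `G₀ = I_𝔓|_L`, same kernel as `ρ̄`)
  set I := 𝔓.inertia (absoluteGaloisGroup ℚ) with hIdef
  have hGI : G₀ = I.map (absRestrictNormalHom L) := by
    rw [hG₀, hPL]; exact inertia_comap_eq_map_absRestrictNormalHom (R := 𝓞 ℚ) 𝔓 L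
  have hker : (absRestrictNormalHom L).ker = (galoisRepTorsion W p).ker := by
    ext σ
    simp only [MonoidHom.mem_ker]
    exact (W.absRestrictNormalHom_divisionField_eq_one_iff p σ).trans
      (galoisRepTorsion_eq_one_iff' W p σ).symm
  have hcardA : Nat.card G₀ = Nat.card (I.map (galoisRepTorsion W p)) := by
    rw [hGI, ← Subgroup.relIndex_ker, ← Subgroup.relIndex_ker, hker]
  have htr : ∀ x y : absoluteGaloisGroup ℚ,
      absRestrictNormalHom L x = absRestrictNormalHom L y ↔
        galoisRepTorsion W p x = galoisRepTorsion W p y :=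
    apply_eq_iff_of_ker_eq' _ _ hker
  -- `G₁ = 1`: a `p`-group of order dividing `e_p`, `p ∤ e_p`
  have hG₁bot : G₁ = ⊥ := by
    obtain ⟨k, hk⟩ := hG₁p.exists_card_eq
    have hdvd : Nat.card G₁ ∣ Nat.card G₀ := Subgroup.card_dvd_of_le hG₁le
    rw [hk, hcardA] at hdvd
    have hk0 : k = 0 := by
      by_contra hk0
      exact hI ((dvd_pow_self p hk0).trans hdvd)
    rw [hk0, pow_zero] at hk
    exact Subgroup.eq_bot_of_card_eq G₁ hk
  -- lift the tame generator `g` to `s ∈ I_𝔓`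
  have hgmap : g ∈ I.map (absRestrictNormalHom L) := by rw [← hGI]; exact hgG₀
  obtain ⟨s, hsI, hs⟩ := Subgroup.mem_map.mp hgmap
  refine ⟨s, hsI, fun x hx ↦ ?_⟩
  have hxG₀ : absRestrictNormalHom L x ∈ G₀ := by
    rw [hGI]; exact Subgroup.mem_map_of_mem _ hx
  obtain ⟨k, τ, hτ, hxk⟩ := hgen _ hxG₀
  have hτ1 : τ = 1 := by
    have hτ' : τ ∈ G₁ := hτ
    rw [hG₁bot] at hτ'
    exact Subgroup.mem_bot.mp hτ'
  refine ⟨k, ?_⟩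
  have h1 : absRestrictNormalHom L x = absRestrictNormalHom L (s ^ k) := by
    rw [hxk, hτ1, mul_one, map_zpow, hs]
  rw [← map_zpow]
  exact (htr _ _).mp h1

/-- **`p ∤ e_p ⟹` every `x ∈ I_𝔓` ACTS on `E[p]` as a power of one `s ∈ I_𝔓`.**
[cite: SerreLocalFields1979, Ch. IV §2 Prop. 7, Cor. 1 and Cor. 3] -/
theorem exists_generator_inertia_smul_of_not_dvd_card
    {v : HeightOneSpectrum (𝓞 ℚ)} (hv : ((p : ℕ) : 𝓞 ℚ) ∈ v.asIdeal)
    {𝔓 : Ideal (absIntegers (𝓞 ℚ) ℚ)} (h𝔓 : 𝔓 ∈ v.primesAbove)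
    (hI : ¬ p ∣ Nat.card ((𝔓.inertia (absoluteGaloisGroup ℚ)).map (galoisRepTorsion W p))) :
    ∃ s ∈ 𝔓.inertia (absoluteGaloisGroup ℚ), ∀ x ∈ 𝔓.inertia (absoluteGaloisGroup ℚ),
      ∃ k : ℤ, ∀ P : geomTorsion W (p : ℤ), x • P = s ^ k • P := by
  obtain ⟨s, hsI, hgen⟩ := exists_generator_inertia_galoisRepTorsion_of_not_dvd_card hv h𝔓 hI
  refine ⟨s, hsI, fun x hx ↦ ?_⟩
  obtain ⟨k, hk⟩ := hgen x hx
  refine ⟨k, fun P ↦ ?_⟩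
  rw [← galoisRepTorsion_apply W (p : ℤ) x P, ← galoisRepTorsion_apply W (p : ℤ) (s ^ k) P,
    map_zpow, hk]

/-- **`p ∤ e_p ⟹ ρ̄_{E,p}(I_𝔓) = ⟨ρ̄(s)⟩` as a subgroup**, for some `s ∈ I_𝔓`.
[cite: SerreLocalFields1979, Ch. IV §2 Prop. 7, Cor. 1 and Cor. 3] -/
theorem exists_inertia_map_galoisRepTorsion_eq_zpowers_of_not_dvd_card
    {v : HeightOneSpectrum (𝓞 ℚ)} (hv : ((p : ℕ) : 𝓞 ℚ) ∈ v.asIdeal)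
    {𝔓 : Ideal (absIntegers (𝓞 ℚ) ℚ)} (h𝔓 : 𝔓 ∈ v.primesAbove)
    (hI : ¬ p ∣ Nat.card ((𝔓.inertia (absoluteGaloisGroup ℚ)).map (galoisRepTorsion W p))) :
    ∃ s ∈ 𝔓.inertia (absoluteGaloisGroup ℚ),
      (𝔓.inertia (absoluteGaloisGroup ℚ)).map (galoisRepTorsion W p) =
        Subgroup.zpowers (galoisRepTorsion W p s) := by
  obtain ⟨s, hsI, hgen⟩ := exists_generator_inertia_galoisRepTorsion_of_not_dvd_card hv h𝔓 hI
  refine ⟨s, hsI, le_antisymm ?_ ?_⟩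
  · rintro _ ⟨x, hx, rfl⟩
    obtain ⟨k, hk⟩ := hgen x hx
    rw [hk]
    exact Subgroup.zpow_mem_zpowers _ _
  · rw [Subgroup.zpowers_le]
    exact ⟨s, hsI, rfl⟩

/-- **`p ∤ e_p ⟹ ρ̄_{E,p}(I_𝔓)` is CYCLIC** ("le groupe d'inertie modérée est procyclique").
[cite: SerreLocalFields1979, Ch. IV §2 Prop. 7, Cor. 1 and Cor. 3] -/
theorem isCyclic_inertia_map_galoisRepTorsion_of_not_dvd_card
    {v : HeightOneSpectrum (𝓞 ℚ)} (hv : ((p : ℕ) : 𝓞 ℚ) ∈ v.asIdeal)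
    {𝔓 : Ideal (absIntegers (𝓞 ℚ) ℚ)} (h𝔓 : 𝔓 ∈ v.primesAbove)
    (hI : ¬ p ∣ Nat.card ((𝔓.inertia (absoluteGaloisGroup ℚ)).map (galoisRepTorsion W p))) :
    IsCyclic ((𝔓.inertia (absoluteGaloisGroup ℚ)).map (galoisRepTorsion W p)) := by
  obtain ⟨s, -, h⟩ := exists_inertia_map_galoisRepTorsion_eq_zpowers_of_not_dvd_card hv h𝔓 hI
  rw [h]
  infer_instance

/-- **`p ∤ e_p ⟹ e_p = ord ρ̄(s)`** for the generator `s` of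
`exists_generator_inertia_galoisRepTorsion_of_not_dvd_card`. [folklore] -/
theorem exists_card_inertia_map_eq_orderOf_of_not_dvd_card
    {v : HeightOneSpectrum (𝓞 ℚ)} (hv : ((p : ℕ) : 𝓞 ℚ) ∈ v.asIdeal)
    {𝔓 : Ideal (absIntegers (𝓞 ℚ) ℚ)} (h𝔓 : 𝔓 ∈ v.primesAbove)
    (hI : ¬ p ∣ Nat.card ((𝔓.inertia (absoluteGaloisGroup ℚ)).map (galoisRepTorsion W p))) :
    ∃ s ∈ 𝔓.inertia (absoluteGaloisGroup ℚ),
      (∀ x ∈ 𝔓.inertia (absoluteGaloisGroup ℚ), ∃ k : ℤ, galoisRepTorsion W p x = galoisRepTorsion W p s ^ k) ∧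
      Nat.card ((𝔓.inertia (absoluteGaloisGroup ℚ)).map (galoisRepTorsion W p)) =
        orderOf (galoisRepTorsion W p s) := by
  obtain ⟨s, hsI, hgen⟩ := exists_generator_inertia_galoisRepTorsion_of_not_dvd_card hv h𝔓 hI
  refine ⟨s, hsI, hgen, ?_⟩
  have h : (𝔓.inertia (absoluteGaloisGroup ℚ)).map (galoisRepTorsion W p) =
      Subgroup.zpowers (galoisRepTorsion W p s) := by
    refine le_antisymm ?_ (by rw [Subgroup.zpowers_le]; exact ⟨s, hsI, rfl⟩)
    rintro _ ⟨x, hx, rfl⟩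
    obtain ⟨k, hk⟩ := hgen x hx
    rw [hk]
    exact Subgroup.zpow_mem_zpowers _ _
  rw [h, Nat.card_zpowers]

/-- **Small image ⟹ cyclic tame inertia at `p`**: under `Irr W p ∧ ¬ Surj W p` (part 4:
`p ∤ #ρ̄(H)` for every `H`) the image `ρ̄_{E,p}(I_𝔓)` is cyclic of order prime to `p` — on EVERY
row of irreducible non-surjective image, whatever the reduction type at `p`.
[cite: Serre1972, §2.4 Prop. 15] [cite: SerreLocalFields1979, Ch. IV §2 Prop. 7, Cor. 1 and Cor. 3] -/
theorem isCyclic_inertia_map_galoisRepTorsion_of_irr_of_not_surj (hirr : Irr W p) (hns : ¬ Surj W p)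
    {v : HeightOneSpectrum (𝓞 ℚ)} (hv : ((p : ℕ) : 𝓞 ℚ) ∈ v.asIdeal)
    {𝔓 : Ideal (absIntegers (𝓞 ℚ) ℚ)} (h𝔓 : 𝔓 ∈ v.primesAbove) :
    IsCyclic ((𝔓.inertia (absoluteGaloisGroup ℚ)).map (galoisRepTorsion W p)) :=
  isCyclic_inertia_map_galoisRepTorsion_of_not_dvd_card hv h𝔓
    (not_dvd_card_map_galoisRepTorsion_of_irr_of_not_surj W p hirr hns _)

/-- **Small image ⟹ one tame generator** (smul form). [cite: Serre1972, §2.4 Prop. 15]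
[cite: SerreLocalFields1979, Ch. IV §2 Prop. 7, Cor. 1 and Cor. 3] -/
theorem exists_generator_inertia_smul_of_irr_of_not_surj (hirr : Irr W p) (hns : ¬ Surj W p)
    {v : HeightOneSpectrum (𝓞 ℚ)} (hv : ((p : ℕ) : 𝓞 ℚ) ∈ v.asIdeal)
    {𝔓 : Ideal (absIntegers (𝓞 ℚ) ℚ)} (h𝔓 : 𝔓 ∈ v.primesAbove) :
    ∃ s ∈ 𝔓.inertia (absoluteGaloisGroup ℚ), ∀ x ∈ 𝔓.inertia (absoluteGaloisGroup ℚ),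
      ∃ k : ℤ, ∀ P : geomTorsion W (p : ℤ), x • P = s ^ k • P :=
  exists_generator_inertia_smul_of_not_dvd_card hv h𝔓
    (not_dvd_card_map_galoisRepTorsion_of_irr_of_not_surj W p hirr hns _)

/-! ## §1b. A stable pair forces `e_p ∣ p − 1` (niveau 1), every `p` -/

/-- **Stable pair ⟹ `e_p ∣ p − 1`.**  On a stable pair every `σ ∈ I` has `σ^{p−1} = 1` on `E[p]`
(part 4, `pow_sub_one_smul_eq_self_of_stablePair`), in particular the tame generator `s`, and
`e_p = ord ρ̄(s)`. [cite: SerreLocalFields1979, Ch. IV §2 Cor. 1–3] [cite: Serre1972, §1.3] -/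
theorem card_inertia_map_dvd_sub_one_of_stablePair
    {v : HeightOneSpectrum (𝓞 ℚ)} (hv : ((p : ℕ) : 𝓞 ℚ) ∈ v.asIdeal)
    {𝔓 : Ideal (absIntegers (𝓞 ℚ) ℚ)} (h𝔓 : 𝔓 ∈ v.primesAbove)
    (h : ∃ X Y : AddSubgroup (geomTorsion W (p : ℤ)), Nat.card X = p ∧ Nat.card Y = p ∧
      X ⊓ Y = ⊥ ∧ X ⊔ Y = ⊤ ∧
      (∀ σ ∈ 𝔓.inertia (absoluteGaloisGroup ℚ), ∀ P ∈ X, σ • P ∈ X) ∧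
      (∀ σ ∈ 𝔓.inertia (absoluteGaloisGroup ℚ), ∀ P ∈ Y, σ • P ∈ Y)) :
    Nat.card ((𝔓.inertia (absoluteGaloisGroup ℚ)).map (galoisRepTorsion W p)) ∣ p - 1 := by
  have hI := not_dvd_card_map_galoisRepTorsion_of_stablePair (W := W) (p := p) h
  obtain ⟨s, hsI, -, hcard⟩ := exists_card_inertia_map_eq_orderOf_of_not_dvd_card hv h𝔓 hI
  rw [hcard]
  apply orderOf_dvd_of_pow_eq_one
  rw [← map_pow, galoisRepTorsion_eq_one_iff' W p]
  intro P
  exact pow_sub_one_smul_eq_self_of_stablePair h hsI P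

end Cyclic

end Summit.BirchSwinnertonDyer.Rank1Residual.GaloisImage

end
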